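import Summits.BirchSwinnertonDyer.BirchSwinnertonDyer.Theorems.GenusKolyvaginAtTwoGenusDeepSupplyAtTwoNegDiscNarrowKFourCellShaTwoRank
import Literature.NumberTheory.EllipticCurves.HeegnerPointsKolyvaginPrimaryEigenProofs
import HarnessLib

/-!
# Route `GenusKolyvaginAtTwo`, crux 23491 `GenusDeepSupplyAtTwoNegDiscNarrow`, K₄ cell (`#Sel₂(E) = 4`, positive Kolyvagin depth):
# THE STRUCTURE OF `Ш(E/K)[2^∞]` ON THE K₄ CELL — `Ш(E_K/K)[2^∞] ≃ ℤ/2^e × ℤ/2^e`, `#Ш(E_K/K)[2^∞] = 4^e`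

LEAD seat `bsd-line-gk2-p1` g22 (cell `bsd-f1-sign2`), `--supports stmt-BirchSwinnertonDyer-23491 --as helper`; sequel of
`…NegDiscNarrowKFourCellShaTwoRank` (p765896: `#Ш(E_K/K)[2] = 4` on the cell).  THEOREMS ONLY (no definition, no named fact, no `sorry`).
**BSD is NOT proved by this file, no item is closed, the registered stub C‴ is untouched.**  Same two displayed print hypotheses (hPT, hEP).

* §1 (pure group theory) `exists_addEquiv_zmod_prod_zmod_of_natCard_torsionBy_two_eq_four` — a finite abelian group all of whose elements are
  `2`-power torsion, hyperbolic (`G ≃ L × L`, Cassels–Tate/Wall), with `#G[2] = 4`, is `≃ ℤ/2^e × ℤ/2^e` and has order `4^e`: `#L[2] = 2`, so `L` is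
  cyclic (tree `KolyvaginEigenPow.isAddCyclic_of_card_torsion_le`, McCallum Lemma 5.3 bookkeeping) of order `2^e` (`zmodAddCyclicAddEquiv`).
* §2 **`exists_addEquiv_sha_primary_zmod_sq_of_cell`** — ON THE K₄ CELL (hypotheses of p765896 §4 verbatim):
  `∃ e, Ш(E_K/K)[2^∞] ≃+ ZMod (2^e) × ZMod (2^e) ∧ #Ш(E_K/K)[2^∞] = 4^e`.

READING (the positive-depth content of C‴, LEAD-BRIEF-g22 §3).  Kolyvagin–McCallum structure at `p` (McCallum 1991 §5: `Ш(E/K)[p^∞] ≅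
⊕_{i≥1} (ℤ/p^{M_{i−1}−M_i})²`; at `p = 2` in deep currency NOT in print) has exactly ONE block on this cell: `M₀ − M₁ = e`, `M₁ = M₂ = … = M_∞`.
So **C‴'s witness «some square-free n of deep primes with P(n) ∉ 2E(K[n])» (= `M_∞ = 0`) is EQUIVALENT, structure-side, to «some SINGLE deep
prime ℓ₁ with P(ℓ₁) ∉ 2E(K[ℓ₁])» (= `M₁ = 0`)**, and U_T (`#Ш ∣ 4^{M₀}`, proved mod Q2) reads `e ≤ M₀`, BSD reads `e = M₀`.  Nothing here proves
K₄ or BSD; `e` is NOT computed.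

References: [McCallumLMS1991] §5 (Lemma 5.3, Thm. 5.?); [Cassels1962ArithmeticIV]; [Wall1963QuadraticFormsFiniteGroups] Lemma 7; [Kramer1981] Thm. 1;
[MilneADT2006] I Thm. 2.8, 4.10, 6.13.
-/

set_option linter.dupNamespace false -- tree convention: `Summit.BirchSwinnertonDyer.BirchSwinnertonDyer.Theorems` (summit = sub-problem)
set_option autoImplicit false

noncomputable section

open scoped Classical

namespace Summit.BirchSwinnertonDyer.BirchSwinnertonDyer.Theorems.GenusSupplyNarrow.KFourCell

open WeierstrassCurve NumberField IsDedekindDomain Field Function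
open Literature.NumberTheory.EllipticCurves Literature.NumberTheory.GaloisRepresentations
open Literature.NumberTheory.GaloisCohomology

/-! ## §1 Hyperbolic finite abelian `2`-groups with `#G[2] = 4` are `(ℤ/2^e)²` -/

section Group

/-- An additive isomorphism identifies the `n`-torsion subgroups (as cardinalities). [folklore] -/
private theorem natCard_torsionBy_congr' {A B : Type*} [AddCommGroup A] [AddCommGroup B] (e : A ≃+ B) (n : ℕ) :
    Nat.card (AddSubgroup.torsionBy A (n : ℤ)) = Nat.card (AddSubgroup.torsionBy B (n : ℤ)) :=
  Nat.card_congr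
    { toFun := fun x => ⟨e x, AddSubgroup.torsionBy.nsmul_iff.mpr (by
        rw [← map_nsmul, AddSubgroup.torsionBy.nsmul_iff.mp x.2, map_zero])⟩
      invFun := fun y => ⟨e.symm y, AddSubgroup.torsionBy.nsmul_iff.mpr (by
        rw [← map_nsmul, AddSubgroup.torsionBy.nsmul_iff.mp y.2, map_zero])⟩
      left_inv := fun x => Subtype.ext (e.symm_apply_apply x)
      right_inv := fun y => Subtype.ext (e.apply_symm_apply y) }

/-- `(A × B)[n] ≃ A[n] × B[n]`, as cardinalities. [folklore] -/
private theorem natCard_torsionBy_prod' {A B : Type*} [AddCommGroup A] [AddCommGroup B] (n : ℕ) :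
    Nat.card (AddSubgroup.torsionBy (A × B) (n : ℤ)) =
      Nat.card (AddSubgroup.torsionBy A (n : ℤ)) * Nat.card (AddSubgroup.torsionBy B (n : ℤ)) := by
  rw [← Nat.card_prod]
  exact Nat.card_congr
    { toFun := fun x =>
        (⟨x.1.1, AddSubgroup.torsionBy.nsmul_iff.mpr (by
            have h := AddSubgroup.torsionBy.nsmul_iff.mp x.2
            rw [Prod.ext_iff] at h
            simpa using h.1)⟩,
          ⟨x.1.2, AddSubgroup.torsionBy.nsmul_iff.mpr (by
            have h := AddSubgroup.torsionBy.nsmul_iff.mp x.2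
            rw [Prod.ext_iff] at h
            simpa using h.2)⟩)
      invFun := fun y => ⟨(y.1.1, y.2.1), AddSubgroup.torsionBy.nsmul_iff.mpr (by
            rw [Prod.ext_iff]
            exact ⟨by simpa using AddSubgroup.torsionBy.nsmul_iff.mp y.1.2,
              by simpa using AddSubgroup.torsionBy.nsmul_iff.mp y.2.2⟩)⟩
      left_inv := fun x => Subtype.ext rfl
      right_inv := fun y => Prod.ext (Subtype.ext rfl) (Subtype.ext rfl) }

/-- In a finite abelian group whose elements are `2`-power torsion, `2^{#G} • g = 0` for every `g` (`ord g = 2^j ∣ #G`, so `j < #G`). [folklore] -/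
theorem two_pow_natCard_nsmul_eq_zero {G : Type*} [AddCommGroup G] [Finite G] (hG : ∀ g : G, ∃ k : ℕ, 2 ^ k • g = 0) (g : G) :
    2 ^ Nat.card G • g = 0 := by
  obtain ⟨k, hk⟩ := hG g
  have hord : addOrderOf g ∣ 2 ^ k := addOrderOf_dvd_iff_nsmul_eq_zero.mpr hk
  obtain ⟨j, -, hj⟩ := (Nat.dvd_prime_pow Nat.prime_two).mp hord
  have hjcard : 2 ^ j ∣ Nat.card G := hj ▸ addOrderOf_dvd_natCard g
  have hpos : 0 < Nat.card G := Nat.card_pos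
  have hjle : 2 ^ j ≤ Nat.card G := Nat.le_of_dvd hpos hjcard
  have hjlt : j ≤ Nat.card G := (Nat.lt_two_pow_self).le.trans hjle
  apply addOrderOf_dvd_iff_nsmul_eq_zero.mp
  rw [hj]
  exact Nat.pow_dvd_pow 2 hjlt

/-- **A hyperbolic finite abelian `2`-group with `#G[2] = 4` is `ℤ/2^e × ℤ/2^e`.**  `G` finite abelian, every element `2`-power torsion,
`G ≃ L × L` for a subgroup `L` (the Lagrangian of an alternating non-degenerate pairing — Cassels–Tate on `Ш[2^∞]`), `#G[2] = 4`: then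
`#L[2] = 2`, `L` is cyclic (`KolyvaginEigenPow.isAddCyclic_of_card_torsion_le`) of order `2^e`, and `G ≃ ℤ/2^e × ℤ/2^e`, `#G = 4^e`.
[cite: Wall1963QuadraticFormsFiniteGroups, Lemma 7] [cite: McCallumLMS1991, §5 Lemma 5.3] -/
theorem exists_addEquiv_zmod_prod_zmod_of_natCard_torsionBy_two_eq_four {G : Type*} [AddCommGroup G] [Finite G]
    (hG : ∀ g : G, ∃ k : ℕ, 2 ^ k • g = 0) {L : AddSubgroup G} (eL : G ≃+ L × L)
    (h4 : Nat.card (AddSubgroup.torsionBy G ((2 : ℕ) : ℤ)) = 4) :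
    ∃ e : ℕ, Nonempty (G ≃+ ZMod (2 ^ e) × ZMod (2 ^ e)) ∧ Nat.card G = 4 ^ e := by
  -- `#L[2] = 2`
  have hL2 : Nat.card (AddSubgroup.torsionBy L ((2 : ℕ) : ℤ)) = 2 := by
    have h := h4
    rw [natCard_torsionBy_congr' eL 2, natCard_torsionBy_prod'] at h
    have hle : Nat.card (AddSubgroup.torsionBy L ((2 : ℕ) : ℤ)) ≤ 2 := by nlinarith
    interval_cases (Nat.card (AddSubgroup.torsionBy L ((2 : ℕ) : ℤ))) <;> omega
  -- `L` is a finite abelian `2`-group with `#L[2] ≤ 2`, hence cyclic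
  haveI : Finite L := Finite.of_injective _ Subtype.val_injective
  have hLtors : ∀ g : L, 2 ^ Nat.card G • g = 0 := fun g ↦ by
    apply Subtype.ext
    rw [AddSubgroupClass.coe_nsmul, ZeroMemClass.coe_zero]
    exact two_pow_natCard_nsmul_eq_zero hG g.1
  have hLp : Nat.card {g : L // 2 • g = 0} ≤ 2 := by
    have h : Nat.card {g : L // 2 • g = 0} = Nat.card (AddSubgroup.torsionBy L ((2 : ℕ) : ℤ)) :=
      Nat.card_congr (Equiv.subtypeEquivRight fun g ↦ (AddSubgroup.torsionBy.nsmul_iff (x := g)).symm)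
    rw [h, hL2]
  have hcyc : IsAddCyclic L := KolyvaginEigenPow.isAddCyclic_of_card_torsion_le Nat.prime_two hLtors hLp
  -- `#L = 2^e`
  obtain ⟨g₀, hg₀⟩ := IsAddCyclic.exists_ofOrder_eq_natCard (α := L)
  have hord : addOrderOf g₀ ∣ 2 ^ Nat.card G := addOrderOf_dvd_iff_nsmul_eq_zero.mpr (hLtors g₀)
  obtain ⟨e, -, he⟩ := (Nat.dvd_prime_pow Nat.prime_two).mp hord
  have hcardL : Nat.card L = 2 ^ e := by rw [← hg₀, he]
  -- `G ≃ L × L ≃ ℤ/2^e × ℤ/2^e`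
  have eZ : L ≃+ ZMod (2 ^ e) := hcardL ▸ (zmodAddCyclicAddEquiv hcyc).symm
  refine ⟨e, ⟨eL.trans (AddEquiv.prodCongr eZ eZ)⟩, ?_⟩
  rw [Nat.card_congr eL.toEquiv, Nat.card_prod, hcardL, show (4 : ℕ) = 2 * 2 from rfl, mul_pow]

end Group

/-! ## §2 The K₄ cell: `Ш(E_K/K)[2^∞] ≃ ℤ/2^e × ℤ/2^e` -/

section Cell

variable (W : WeierstrassCurve ℚ) [W.IsElliptic] [W.IsGloballyMinimal] (K : Type) [Field K] [NumberField K]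

/-- **THE STRUCTURE OF `Ш(E/K)[2^∞]` ON THE K₄ CELL: `Ш(E_K/K)[2^∞] ≃ ℤ/2^e × ℤ/2^e` for some `e`, `#Ш(E_K/K)[2^∞] = 4^e`.**  Hypotheses = those of
`natCard_shaTorsionBy_two_baseChange_eq_four` (p765896 §4) verbatim: `E/ℚ` globally minimal, `Δ_E < 0`, `#Sel₂(E) = 4`; `K` imaginary quadratic,
`d_K = −ℓ` odd, Heegner for `N_E`, `2` split; `Wd` a model of `E^{(d_K)}` with `#Sel₂(Wd) = 2`; `E(K)[2] = 0`; `rank E(K) = 1`; `Ш(E_K/K)[2^∞]` finite;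
print facts hPT/hEP.  Proof: Cassels–Tate hyperbolicity `Ш[2^∞] ≃ L × L` (tree `exists_addEquiv_prod_self_primaryComponent_sha`, unconditional) +
`#Ш[2] = 4` (p765896) + §1.  READING: one Kolyvagin–McCallum block (`M₁ = M_∞`) — the deep witness of C‴ is a single-deep-prime statement
structure-side; `e ≤ M₀` (U_T), BSD ⟹ `e = M₀`.  K₄ and BSD are NOT proved by this.
[cite: Cassels1962ArithmeticIV] [cite: McCallumLMS1991, §5] [cite: Kramer1981, Thm. 1] [cite: MilneADT2006, Ch. I Thm. 2.8, Thm. 4.10, Thm. 6.13] -/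
theorem exists_addEquiv_sha_primary_zmod_sq_of_cell
    (hPT : poitouTate_selmerStructure_duality_real ℚ)
    (hEP : ∀ v : HeightOneSpectrum (𝓞 ℚ), localEulerPoincareCharacteristic (v.adicCompletion ℚ))
    (hΔ : W.Δ < 0) (h4 : Nat.card (W.selmerGroup 2) = 4) (hK : IsImaginaryQuadratic K) (hodd : Odd (discr K))
    (hH : SatisfiesHeegnerHypothesis (W.conductorNorm ℤ) K) (h2K : ((Ideal.span {(2 : ℤ)}).primesOver (𝓞 K)).ncard = 2)
    {ℓ : ℕ} [Fact ℓ.Prime] (hd : discr K = -(ℓ : ℤ))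
    (Wd : WeierstrassCurve ℚ) [Wd.IsElliptic] (hWd : ∃ C : VariableChange ℚ, C • W.quadraticTwist (discr K : ℚ) = Wd)
    (hSel : Nat.card (Wd.selmerGroup 2) = 2)
    (hL : ∀ P : (W.baseChange K).toAffine.Point, ((2 : ℕ) : ℤ) • P = 0 → P = 0)
    (hrk : (W.baseChange K).mordellWeilRank = 1)
    [Finite (AddCommGroup.primaryComponent (W.baseChange K).sha 2)] :
    ∃ e : ℕ, Nonempty (AddCommGroup.primaryComponent (W.baseChange K).sha 2 ≃+ ZMod (2 ^ e) × ZMod (2 ^ e)) ∧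
      Nat.card (AddCommGroup.primaryComponent (W.baseChange K).sha 2) = 4 ^ e := by
  haveI : Fact (Nat.Prime 2) := ⟨Nat.prime_two⟩
  haveI : (W.baseChange K).IsElliptic := inferInstanceAs ((W.map (algebraMap ℚ K)).IsElliptic)
  -- `#Ш[2] = 4` (prequel), transported to the `2`-primary component
  have h4' := (natCard_shaTorsionBy_two_baseChange_eq_four W K hPT hEP hΔ h4 hK hodd hH h2K hd Wd hWd hSel hL hrk).1
  have h4'' : Nat.card (AddSubgroup.torsionBy (AddCommGroup.primaryComponent (W.baseChange K).sha 2) ((2 : ℕ) : ℤ)) = 4 := by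
    have h := GenusExact.CasselsTateNumberField.natCard_sha_torsionBy_pow_eq_primaryComponent (W.baseChange K) 2 1
    rw [pow_one] at h
    rw [← h]
    exact h4'
  -- hyperbolicity of `Ш[2^∞]` (Cassels–Tate over `K`, unconditional)
  obtain ⟨L, ⟨eL⟩⟩ := GenusExact.CasselsTateNumberField.exists_addEquiv_prod_self_primaryComponent_sha (W.baseChange K) 2
  -- every element of the primary component is `2`-power torsion
  have hG : ∀ g : AddCommGroup.primaryComponent (W.baseChange K).sha 2, ∃ k : ℕ, 2 ^ k • g = 0 := fun g ↦ by
    obtain ⟨k, hk⟩ := (AddCommGroup.mem_primaryComponent).mp g.2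
    exact ⟨k, Subtype.ext (by rw [AddSubgroupClass.coe_nsmul, ZeroMemClass.coe_zero]; exact hk)⟩
  exact exists_addEquiv_zmod_prod_zmod_of_natCard_torsionBy_two_eq_four hG eL h4''

end Cell

end Summit.BirchSwinnertonDyer.BirchSwinnertonDyer.Theorems.GenusSupplyNarrow.KFourCell

end
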